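import Literature.Geometry.Kaehler.ComplexTorusAbelianSurfaceRealMultiplicationHodgeLieAlgebraDimension
import Literature.Geometry.Kaehler.ComplexTorusAbelianSurfacePicardNumberThreeHodgeLieAlgebraDimension
import Literature.Geometry.Kaehler.ComplexTorusHodgeLieAlgebraEllipticProducts
import Literature.Geometry.Kaehler.ComplexTorusLefschetzGroupFiniteProduct
import HarnessLib

/-!
# The six absolute types of abelian SURFACES at torus level: for every polarised complex abelian surface
# `(dim_ℝ 𝔥𝔤_ℝ(X), ρ(X), dim_ℚ End⁰(X)) ∈ {(10,1,1), (6,2,2), (4,2,3), (2,2,4), (3,3,4), (1,4,8)}`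
# — Fité–Kedlaya–Rotger–Sutherland's types **A, B, C, D, E, F** (`USp(4)`, `SU(2)², U(1) × SU(2)`, `U(1)²`, `SU(2)`, `U(1)`;
# `End_ℝ = ℝ, ℝ², ℂ × ℝ, ℂ², M₂(ℝ), M₂(ℂ)`), hence the dictionary `dim Hg(X) ↔ (dim_ℚ End⁰(X), ρ(X))`,
# in particular `dim Hg(X) = 3 ⟺ ρ(X) = 3` and the non-simple column `E_{τ₁} × E_{τ₂}`

Layer `Literature/Geometry/Kaehler`, namespace `Literature.Geometry.Kaehler.ComplexTorus`; lane `lit-hodgefound`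
(Track 2 foundations library), Layer A4; prover seat `lit-hodgefound-p17` (generation 49), self-proposed row g49-#5,
sequel BY NAME of g49-#4 (`ComplexTorusAbelianSurfaceRealMultiplicationHodgeLieAlgebraDimension`: the dictionary
`dim_ℝ 𝔥𝔤_ℝ ∈ {10, 6, 3, 2} ↔ End⁰` for SIMPLE surfaces), of g48-#6
(`ComplexTorusAbelianSurfacePicardNumberThreeHodgeLieAlgebraDimension`: `ρ = 3 ⟹ dim_ℝ 𝔥𝔤_ℝ = 3`), of
`ComplexTorusAbelianSurfaceNonSimple` (p17: `X` non-simple `⟹ X ∼ E₁ × E₂` with the table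
`(ρ, dim_ℚ End⁰) ∈ {(2,2), (2,3), (2,4), (3,4), (4,8)}`), of `ComplexTorusHodgeLieAlgebraEllipticProducts`
(`dim_ℝ 𝔥𝔤_ℝ(E_{τ₁} × E_{τ₂}) = 2, 4, 6` by complex multiplication of the factors) and of the isogeny ∕ power
invariances `IsIsogenous.finrank_hodgeGroupLie_eq`, `IsIsogenous.finrank_neronSeveriGroup_eq`,
`IsIsogenous.finrank_endAlgRat_eq`, `finrank_hodgeGroupLie_pow`.

THEOREMS ONLY (no definition, no instance, no notation, no named fact; D-0026, net debt 0); nothing restated — the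
tree's `(ρ, dim End⁰)` tables (`IsRiemannForm.finrank_neronSeveriGroup_and_finrank_endAlgRat_of_finrank_eq_two`,
`…_of_not_isSimple`, `IsSimple.…`) and its list `dim_ℝ 𝔥𝔤_ℝ ∈ {1, 2, 3, 4, 6, 10}`
(`IsRiemannForm.finrank_hodgeGroupLie_mem_six_of_finrank_eq_two`) are JOINED here with a third coordinate, which is
the new content: which dimension of the Hodge group goes with which line of the endomorphism table.

## Sources, VERBATIM (held copies; `p0NNN Lnn` = chunk file and line of the materialised text)

* F. Fité, K. S. Kedlaya, V. Rotger, A. V. Sutherland, *Sato–Tate distributions and Galois endomorphism modules in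
  genus 2*, Compositio Math. 148 (2012), held `paper:arxiv-1110.6638`, §4.1 (p0014 L45–L72): «the `ℝ`-algebra
  `End(A_K)_ℝ` is isomorphic to one of: (**A**) `ℝ`, which is the generic case; (**B**) `ℝ × ℝ`, which occurs when
  either `A_K` is isogenous to a product of nonisogenous elliptic curves without CM, or `A_K` is simple and `End(A_K)`
  is an order in a real quadratic field; (**C**) `ℂ × ℝ`, which occurs when `A_K` is isogenous to a product of
  (necessarily nonisogenous) elliptic curves, one with CM and the other without CM; (**D**) `ℂ × ℂ`, which occurs
  when either `A_K` is isogenous to a product of nonisogenous elliptic curves with CM, or `A_K` is simple and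
  `End(A_K)` is an order in a quartic CM-field; (**E**) `M₂(ℝ)`, which occurs when either `A_K` is isogenous to the
  square of an elliptic curve without CM, or `A_K` is simple and `End(A_K)` is an order in a division quaternion
  algebra over `ℚ`; (**F**) `M₂(ℂ)`, which occurs when `A_K` is isogenous to the square of an elliptic curve with
  CM.»; (p0014 L76–L82) «The six absolute types are in one-to-one correspondence with the six connected Lie subgroups
  of `USp(4)` appearing in Lemma 3.7 […] **A**: `USp(4)`, **B**: `SU(2) × SU(2)`, **C**: `U(1) × SU(2)`,
  **D**: `U(1) × U(1)`, **E**: `SU(2)`, **F**: `U(1)`»; §3.2 Lemma 3.7 (p0011 L60–L66: «this classification is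
  well-known in the context of Mumford-Tate groups»).  The three coordinates of the present table are
  `dim_ℝ` of these groups (`10, 6, 4, 2, 3, 1`), the Picard number, and `dim_ℝ End(A)_ℝ = dim_ℚ End⁰(A)`
  (`1, 2, 3, 4, 4, 8`).
* B. Moonen, Yu. G. Zarhin, *Hodge classes on abelian varieties of low dimension*, Math. Ann. 315 (1999), held
  `paper:arxiv-math_9901113` (no statement numbers in the held TeX), §2 (2.1) `g = 1` (p0005 L43–L47), (2.2) `g = 2`
  (p0005 L53 ff.: the four simple cases I(1), I(2), II(1), IV(2,1)), Prop. (2.4) (p0005 L110 ff.), §1 (powers: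
  `Hg(Xⁿ) ≅ Hg(X)`), (0.2)(4) (isogeny invariance), §3 (products of elliptic curves, p0007 L80–L84).
* K. Hulek, R. Laface, *On the Picard numbers of abelian varieties* (2019), held `paper:arxiv-1703.05882`, §1 (p0003
  L13–L14): «Picard numbers from 2 to 4 can be realized by taking a product `E₁ × E₂` of two elliptic curves. If the
  two elliptic curves are not isogenous, then `ρ = 2`, if they are isogenous but they do not have complex
  multiplication, then `ρ = 3`, while if they also have complex multiplication `ρ = 4`»; §3 («`ρ = 3e` for type II»),
  §5.1 Prop. 5.1.
* H. Lange, *Abelian Varieties over the Complex Numbers* (2023), §5.1.5 Exercise (2)(a), (b) (a non-simple abelian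
  surface is isogenous to `E₁ × E₂`, `End_ℚ(X) = End_ℚ(E₁) ⊕ End_ℚ(E₂)` or `M₂(End_ℚ(E₁))`; the simple table) and
  §2.6.1 Proposition (table).
* A. Beauville, *Some surfaces with maximal Picard number* (2014), §3 Prop. 3 (`ρ = g²` ⟺ `X ∼ Eᵍ`, `E` with CM ⟺
  `Hg(X) = h(S¹)`) — the line `(1, 4, 8)`.

## Contents

* §1 PRODUCTS OF TWO ELLIPTIC CURVES `E_{τ₁} × E_{τ₂}` (the non-simple column of types **B, C, D, E, F**):
  **`finrank_hodgeGroupLie_and_finrank_neronSeveriGroup_and_finrank_endAlgRat_prod_ellipticPeriod`**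
  (`(dim 𝔥𝔤, ρ, dim End⁰) ∈ {(6,2,2), (4,2,3), (2,2,4), (3,3,4), (1,4,8)}`).
* §2 NON-SIMPLE SURFACES: `IsRiemannForm.exists_isIsogenous_prodPeriod_ellipticPeriod_of_not_isSimple_of_finrank_eq_two`
  (`X ∼ E_{τ₁} × E_{τ₂}`), **`IsRiemannForm.finrank_hodgeGroupLie_and_finrank_neronSeveriGroup_and_finrank_endAlgRat_of_not_isSimple`**
  (the same five lines for `X`), `IsRiemannForm.finrank_hodgeGroupLie_mem_of_not_isSimple_of_finrank_eq_two`
  (`dim_ℝ 𝔥𝔤_ℝ ∈ {1, 2, 3, 4, 6}`), `IsRiemannForm.isSimple_of_finrank_hodgeGroupLie_eq_ten`.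
* §3 SIMPLE SURFACES: **`IsSimple.finrank_hodgeGroupLie_and_finrank_neronSeveriGroup_and_finrank_endAlgRat_of_finrank_eq_two`**
  (`∈ {(10,1,1), (6,2,2), (3,3,4), (2,2,4)}`, types I(1), I(2), II(1), IV(2,1)).
* §4 EVERY ABELIAN SURFACE: **`IsRiemannForm.finrank_hodgeGroupLie_and_finrank_neronSeveriGroup_and_finrank_endAlgRat_of_finrank_eq_two`**
  (THE SIX LINES) and the dictionary read off it: `dim_ℝ 𝔥𝔤_ℝ = 10 ⟺ dim End⁰ = 1 ⟺ ρ = 1`, `= 6 ⟺ dim End⁰ = 2`,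
  `= 4 ⟺ dim End⁰ = 3`, **`= 3 ⟺ ρ = 3`** (`⟺ dim End⁰ = 4 ∧ ρ = 3`), `= 2 ⟺ dim End⁰ = 4 ∧ ρ = 2`
  (`⟺ Hg(X)` commutative `∧ ρ = 2`), `= 1 ⟺ dim End⁰ = 8 ⟺ ρ = 4`, `ρ = 2 ⟺ dim_ℝ 𝔥𝔤_ℝ ∈ {2, 4, 6}`, and the
  `IsAbelianVariety` form of `dim 𝔥𝔤 = 3 ⟺ ρ = 3`.
* §5 REALISATION: **`exists_abelianSurface_finrank_hodgeGroupLie_and_finrank_neronSeveriGroup_and_finrank_endAlgRat_eq_iff`**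
  (the set of triples realised by polarised complex abelian surfaces is EXACTLY the six lines — all six types occur),
  `exists_abelianSurface_finrank_hodgeGroupLie_eq_iff` (`{dim Hg(X)} = {1, 2, 3, 4, 6, 10}`).
-/

noncomputable section

open scoped Matrix
open Module Matrix NormedSpace NumberField

namespace Literature.Geometry.Kaehler

namespace ComplexTorus

/-! ## §1 Products of two elliptic curves: the non-simple column of the six types -/

section EllipticProduct

variable {τ₁ τ₂ : ℂ} (hτ₁ : τ₁.im ≠ 0) (hτ₂ : τ₂.im ≠ 0)

/-- `dim_ℚ End_ℚ(E_τ) = 1` for a curve WITHOUT complex multiplication (`End_ℚ(E_τ) = ℚ`).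
[cite: Lange2023AbelianVarietiesComplex, §2.6.1 Proposition, table (`g = 1`)] -/
private theorem finrank_endAlgRat_ellipticPeriod_of_eq_bot₄₉e {τ : ℂ} (hτ : τ.im ≠ 0) (h : ellipticEnd hτ = ⊥) :
    finrank ℚ (endAlgRat (ellipticPeriod hτ)) = 1 := by
  rw [(endAlgRat_ellipticPeriod_eq_bot_iff hτ).2 h]
  exact Subalgebra.finrank_bot

include hτ₁ hτ₂ in
/-- **THE NON-SIMPLE COLUMN OF THE SIX TYPES: for every pair of elliptic curves,
`(dim_ℝ 𝔥𝔤_ℝ, ρ, dim_ℚ End⁰)(E_{τ₁} × E_{τ₂}) ∈ {(6,2,2), (4,2,3), (2,2,4), (3,3,4), (1,4,8)}`** — `E_{τ₁} ≁ E_{τ₂}`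
both without CM: **B** `(6,2,2)` (`𝔰𝔩₂(ℝ)²`); exactly one with CM: **C** `(4,2,3)` (`𝔲(1) ⊕ 𝔰𝔩₂(ℝ)`); both with
CM: **D** `(2,2,4)` (`𝔲(1)²`); `E_{τ₁} ∼ E_{τ₂}` without CM: **E** `(3,3,4)` (`E_{τ₁} × E_{τ₂} ∼ E_{τ₁}²`,
`𝔥𝔤 ≅ 𝔰𝔩₂(ℝ)` diagonal, `End⁰ = M₂(ℚ)`); with CM: **F** `(1,4,8)` (`𝔲(1)`, `End⁰ = M₂(K)`).
[cite: FiteEtAl2012, §4.1 (p0014 L45–L82: types **B**–**F**, the non-simple alternatives, `↔ SU(2) × SU(2), U(1) × SU(2), U(1) × U(1), SU(2), U(1)`) and §3.2 Lemma 3.7]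
[cite: HulekLaface2019PicardNumbersAV, §1 (p0003 L13–L14: `ρ(E₁ × E₂) = 2, 3, 4`)] [cite: MoonenZarhin1999LowDim, §2 (2.1) `g = 1`, §1 (powers), (0.2)(4), §3 (products of elliptic curves)]
[cite: Lange2023AbelianVarietiesComplex, §5.1.5 Exercise (2)(a)] -/
theorem finrank_hodgeGroupLie_and_finrank_neronSeveriGroup_and_finrank_endAlgRat_prod_ellipticPeriod :
    (finrank ℝ (hodgeGroupLie (prodPeriod (ellipticPeriod hτ₁) (ellipticPeriod hτ₂))) = 6 ∧
        finrank ℤ (neronSeveriGroup (prodPeriod (ellipticPeriod hτ₁) (ellipticPeriod hτ₂))) = 2 ∧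
          finrank ℚ (endAlgRat (prodPeriod (ellipticPeriod hτ₁) (ellipticPeriod hτ₂))) = 2) ∨
      (finrank ℝ (hodgeGroupLie (prodPeriod (ellipticPeriod hτ₁) (ellipticPeriod hτ₂))) = 4 ∧
        finrank ℤ (neronSeveriGroup (prodPeriod (ellipticPeriod hτ₁) (ellipticPeriod hτ₂))) = 2 ∧
          finrank ℚ (endAlgRat (prodPeriod (ellipticPeriod hτ₁) (ellipticPeriod hτ₂))) = 3) ∨
      (finrank ℝ (hodgeGroupLie (prodPeriod (ellipticPeriod hτ₁) (ellipticPeriod hτ₂))) = 2 ∧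
        finrank ℤ (neronSeveriGroup (prodPeriod (ellipticPeriod hτ₁) (ellipticPeriod hτ₂))) = 2 ∧
          finrank ℚ (endAlgRat (prodPeriod (ellipticPeriod hτ₁) (ellipticPeriod hτ₂))) = 4) ∨
      (finrank ℝ (hodgeGroupLie (prodPeriod (ellipticPeriod hτ₁) (ellipticPeriod hτ₂))) = 3 ∧
        finrank ℤ (neronSeveriGroup (prodPeriod (ellipticPeriod hτ₁) (ellipticPeriod hτ₂))) = 3 ∧
          finrank ℚ (endAlgRat (prodPeriod (ellipticPeriod hτ₁) (ellipticPeriod hτ₂))) = 4) ∨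
      (finrank ℝ (hodgeGroupLie (prodPeriod (ellipticPeriod hτ₁) (ellipticPeriod hτ₂))) = 1 ∧
        finrank ℤ (neronSeveriGroup (prodPeriod (ellipticPeriod hτ₁) (ellipticPeriod hτ₂))) = 4 ∧
          finrank ℚ (endAlgRat (prodPeriod (ellipticPeriod hτ₁) (ellipticPeriod hτ₂))) = 8) := by
  have hY : Fintype.card (Fin 2) = 2 := Fintype.card_fin 2
  have hYa : IsAbelianVariety (ellipticPeriod hτ₁) := isAbelianVariety_ellipticPeriod hτ₁
  have hrefl : IsIsogenous (prodPeriod (ellipticPeriod hτ₁) (ellipticPeriod hτ₂))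
      (prodPeriod (ellipticPeriod hτ₁) (ellipticPeriod hτ₂)) := IsIsogenous.refl _
  by_cases hYZ : IsIsogenous (ellipticPeriod hτ₁) (ellipticPeriod hτ₂)
  · -- `E_{τ₁} ∼ E_{τ₂}`: `ρ = 2 + d₁`, `dim End⁰ = 4 d₁`, `E_{τ₁} × E_{τ₂} ∼ E_{τ₁}²`, `𝔥𝔤(E²) ≅ 𝔥𝔤(E)`
    have hρ := hrefl.finrank_neronSeveriGroup_eq_two_add_of_isIsogenous hY hY hYa hYZ
    have hd := hrefl.finrank_endAlgRat_eq_four_mul_of_isIsogenous hYZ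
    have h2 : IsIsogenous (prodPeriod (ellipticPeriod hτ₁) (ellipticPeriod hτ₂)) (powPeriod (ellipticPeriod hτ₁) 2) :=
      (IsIsogenous.refl (ellipticPeriod hτ₁)).prod_powPeriod_two (IsIsogenous.symm _ _ hYZ)
    have hhg : finrank ℝ (hodgeGroupLie (prodPeriod (ellipticPeriod hτ₁) (ellipticPeriod hτ₂))) =
        finrank ℝ (hodgeGroupLie (ellipticPeriod hτ₁)) := by
      rw [h2.finrank_hodgeGroupLie_eq, finrank_hodgeGroupLie_pow (ellipticPeriod hτ₁) two_pos]
    by_cases h₁ : ellipticEnd hτ₁ = ⊥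
    · -- **E**: `(3, 3, 4)`
      have hd₁ := finrank_endAlgRat_ellipticPeriod_of_eq_bot₄₉e hτ₁ h₁
      have h3 := finrank_hodgeGroupLie_ellipticPeriod_of_eq_bot hτ₁ h₁
      exact Or.inr (Or.inr (Or.inr (Or.inl ⟨by rw [hhg, h3], by rw [hρ, hd₁], by rw [hd, hd₁]⟩)))
    · -- **F**: `(1, 4, 8)`
      have hd₁ := finrank_endAlgRat_ellipticPeriod_of_cm hτ₁ h₁
      have h1 := finrank_hodgeGroupLie_ellipticPeriod_of_ne_bot hτ₁ h₁
      exact Or.inr (Or.inr (Or.inr (Or.inr ⟨by rw [hhg, h1], by rw [hρ, hd₁], by rw [hd, hd₁]⟩)))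
  · -- `E_{τ₁} ≁ E_{τ₂}`: `ρ = 2`, `dim End⁰ = d₁ + d₂`
    have hρ := hrefl.finrank_neronSeveriGroup_eq_two_of_not_isIsogenous hY hY hYa hYZ
    have hd := hrefl.finrank_endAlgRat_eq_add_of_not_isIsogenous hY hY hYZ
    by_cases h₁ : ellipticEnd hτ₁ = ⊥ <;> by_cases h₂ : ellipticEnd hτ₂ = ⊥
    · -- **B**: `(6, 2, 2)`
      have h6 := (finrank_triple_prod_ellipticPeriod_of_eq_bot_of_not_isIsogenous hτ₁ hτ₂ h₁ h₂ hYZ).2.2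
      have hd₁ := finrank_endAlgRat_ellipticPeriod_of_eq_bot₄₉e hτ₁ h₁
      have hd₂ := finrank_endAlgRat_ellipticPeriod_of_eq_bot₄₉e hτ₂ h₂
      exact Or.inl ⟨h6, hρ, by rw [hd, hd₁, hd₂]⟩
    · -- **C**: `(4, 2, 3)`
      have h4 := (finrank_triple_prod_ellipticPeriod_of_eq_bot_of_ne_bot hτ₁ hτ₂ h₁ h₂).2.2
      have hd₁ := finrank_endAlgRat_ellipticPeriod_of_eq_bot₄₉e hτ₁ h₁
      have hd₂ := finrank_endAlgRat_ellipticPeriod_of_cm hτ₂ h₂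
      exact Or.inr (Or.inl ⟨h4, hρ, by rw [hd, hd₁, hd₂]⟩)
    · -- **C**: `(4, 2, 3)`
      have h4 := (finrank_triple_prod_ellipticPeriod_of_ne_bot_of_eq_bot hτ₁ hτ₂ h₁ h₂).2.2
      have hd₁ := finrank_endAlgRat_ellipticPeriod_of_cm hτ₁ h₁
      have hd₂ := finrank_endAlgRat_ellipticPeriod_of_eq_bot₄₉e hτ₂ h₂
      exact Or.inr (Or.inl ⟨h4, hρ, by rw [hd, hd₁, hd₂]⟩)
    · -- **D**: `(2, 2, 4)`
      obtain ⟨p₁, q₁, hq₁⟩ := (ellipticEnd_ne_bot_iff hτ₁).1 h₁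
      obtain ⟨p₂, q₂, hq₂⟩ := (ellipticEnd_ne_bot_iff hτ₂).1 h₂
      have h2 := (finrank_triple_prod_ellipticPeriod_of_not_isIsogenous_of_ne_bot hτ₁ hτ₂ hq₁ hq₂ hYZ).2.2
      have hd₁ := finrank_endAlgRat_ellipticPeriod_of_cm hτ₁ h₁
      have hd₂ := finrank_endAlgRat_ellipticPeriod_of_cm hτ₂ h₂
      exact Or.inr (Or.inr (Or.inl ⟨h2, hρ, by rw [hd, hd₁, hd₂]⟩))

include hτ₁ hτ₂ in
/-- `dim_ℝ 𝔥𝔤_ℝ(E_{τ₁} × E_{τ₂}) ∈ {1, 2, 3, 4, 6}` (`U(1), U(1)², SU(2), U(1) × SU(2), SU(2)²`; never `𝔰𝔭₄`).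
[cite: FiteEtAl2012, §4.1 (p0014 L45–L82) and §3.2 Lemma 3.7] [cite: MoonenZarhin1999LowDim, §3 (products of elliptic curves) and §2 (2.1)] -/
theorem finrank_hodgeGroupLie_prod_ellipticPeriod_mem :
    finrank ℝ (hodgeGroupLie (prodPeriod (ellipticPeriod hτ₁) (ellipticPeriod hτ₂))) ∈ ({1, 2, 3, 4, 6} : Finset ℕ) := by
  simp only [Finset.mem_insert, Finset.mem_singleton]
  rcases finrank_hodgeGroupLie_and_finrank_neronSeveriGroup_and_finrank_endAlgRat_prod_ellipticPeriod hτ₁ hτ₂ with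
    h | h | h | h | h <;> omega

end EllipticProduct

/-! ## §2 Non-simple abelian surfaces -/

section NonSimple

variable {κ : Type} [Fintype κ] [DecidableEq κ] {E : Type} [NormedAddCommGroup E] [NormedSpace ℂ E]
  [FiniteDimensional ℂ E] {Ψ : (κ → ℝ) ≃L[ℝ] E} {η : E [⋀^Fin 2]→L[ℝ] ℝ}

/-- **A non-simple polarised abelian surface is isogenous to a product of two elliptic curves `E_{τ₁} × E_{τ₂}`**
(`E_τ = ℂ/(ℤτ + ℤ)`): Poincaré's complete reducibility gives `X ∼ X₁ × X₂` with one-dimensional factors, and every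
one-dimensional complex torus is an `E_τ`.  (Binary-product form of the tree's `piPeriod` statement
`IsRiemannForm.exists_isIsogenous_piPeriod_ellipticPeriod_of_not_isSimple_of_finrank_eq_two`.)
[cite: Lange2023AbelianVarietiesComplex, §5.1.5 Exercise (2)(a) (PDF p0250 L3–L5) and §1.1.6 Exercise (1)(a)]
[cite: FiteEtAl2012, §4.1 (p0014 L45–L72: «`A_K` is isogenous to a product of … elliptic curves»)] -/
theorem IsRiemannForm.exists_isIsogenous_prodPeriod_ellipticPeriod_of_not_isSimple_of_finrank_eq_two
    (hη : IsRiemannForm Ψ η) (hg : finrank ℂ E = 2) (hX : ¬ IsSimple Ψ) :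
    ∃ (τ₁ τ₂ : ℂ) (hτ₁ : τ₁.im ≠ 0) (hτ₂ : τ₂.im ≠ 0),
      IsIsogenous Ψ (prodPeriod (ellipticPeriod hτ₁) (ellipticPeriod hτ₂)) := by
  obtain ⟨V, hV, hVc, hW, hWc, h1, h2, hiso, -⟩ := hη.exists_isIsogenous_prod_elliptic_of_not_isSimple hg hX
  have hd₁ : finrank ℂ (cxSpan Ψ V) = 1 := by
    have h := subRank_eq_two_mul_finrank Ψ hV hVc
    omega
  have hd₂ : finrank ℂ (cxSpan Ψ (orthSubspace Ψ η V)) = 1 := by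
    have h := subRank_eq_two_mul_finrank Ψ hW hWc
    omega
  obtain ⟨τ₁, hτ₁, e₁⟩ := exists_isIsomorphic_ellipticPeriod (subtorusPeriod Ψ V hV hVc) hd₁
  obtain ⟨τ₂, hτ₂, e₂⟩ := exists_isIsomorphic_ellipticPeriod (subtorusPeriod Ψ (orthSubspace Ψ η V) hW hWc) hd₂
  exact ⟨τ₁, τ₂, hτ₁, hτ₂, IsIsogenous.trans _ _ _ hiso (e₁.prod e₂).isIsogenous⟩

/-- **THE FIVE LINES OF A NON-SIMPLE ABELIAN SURFACE:
`(dim_ℝ 𝔥𝔤_ℝ(X), ρ(X), dim_ℚ End⁰(X)) ∈ {(6,2,2), (4,2,3), (2,2,4), (3,3,4), (1,4,8)}`** (types **B, C, D, E, F**;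
`X ∼ E_{τ₁} × E_{τ₂}` and all three coordinates are isogeny invariants).
[cite: FiteEtAl2012, §4.1 (p0014 L45–L82) and §3.2 Lemma 3.7] [cite: HulekLaface2019PicardNumbersAV, §1 (p0003 L13–L14)]
[cite: MoonenZarhin1999LowDim, (0.2)(4), §1, §2 (2.1), §3] [cite: Lange2023AbelianVarietiesComplex, §5.1.5 Exercise (2)(a)] -/
theorem IsRiemannForm.finrank_hodgeGroupLie_and_finrank_neronSeveriGroup_and_finrank_endAlgRat_of_not_isSimple
    (hη : IsRiemannForm Ψ η) (hg : finrank ℂ E = 2) (hX : ¬ IsSimple Ψ) :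
    (finrank ℝ (hodgeGroupLie Ψ) = 6 ∧ finrank ℤ (neronSeveriGroup Ψ) = 2 ∧ finrank ℚ (endAlgRat Ψ) = 2) ∨
      (finrank ℝ (hodgeGroupLie Ψ) = 4 ∧ finrank ℤ (neronSeveriGroup Ψ) = 2 ∧ finrank ℚ (endAlgRat Ψ) = 3) ∨
      (finrank ℝ (hodgeGroupLie Ψ) = 2 ∧ finrank ℤ (neronSeveriGroup Ψ) = 2 ∧ finrank ℚ (endAlgRat Ψ) = 4) ∨
      (finrank ℝ (hodgeGroupLie Ψ) = 3 ∧ finrank ℤ (neronSeveriGroup Ψ) = 3 ∧ finrank ℚ (endAlgRat Ψ) = 4) ∨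
      (finrank ℝ (hodgeGroupLie Ψ) = 1 ∧ finrank ℤ (neronSeveriGroup Ψ) = 4 ∧ finrank ℚ (endAlgRat Ψ) = 8) := by
  obtain ⟨τ₁, τ₂, hτ₁, hτ₂, h⟩ := hη.exists_isIsogenous_prodPeriod_ellipticPeriod_of_not_isSimple_of_finrank_eq_two hg hX
  rw [h.finrank_hodgeGroupLie_eq, h.finrank_neronSeveriGroup_eq, h.finrank_endAlgRat_eq]
  exact finrank_hodgeGroupLie_and_finrank_neronSeveriGroup_and_finrank_endAlgRat_prod_ellipticPeriod hτ₁ hτ₂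

/-- **`dim_ℝ 𝔥𝔤_ℝ ∈ {1, 2, 3, 4, 6}` for a NON-SIMPLE abelian surface** (never `10`: `Hg(X) = Sp₄` forces
`End⁰(X) = ℚ`). [cite: FiteEtAl2012, §4.1 (p0014 L45–L82) and §3.2 Lemma 3.7] [cite: MoonenZarhin1999LowDim, §3 and §2 (2.1)] -/
theorem IsRiemannForm.finrank_hodgeGroupLie_mem_of_not_isSimple_of_finrank_eq_two (hη : IsRiemannForm Ψ η)
    (hg : finrank ℂ E = 2) (hX : ¬ IsSimple Ψ) : finrank ℝ (hodgeGroupLie Ψ) ∈ ({1, 2, 3, 4, 6} : Finset ℕ) := by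
  simp only [Finset.mem_insert, Finset.mem_singleton]
  rcases hη.finrank_hodgeGroupLie_and_finrank_neronSeveriGroup_and_finrank_endAlgRat_of_not_isSimple hg hX with
    h | h | h | h | h <;> omega

/-- `dim_ℝ 𝔥𝔤_ℝ ≠ 10` for a non-simple abelian surface. [cite: FiteEtAl2012, §4.1 and §3.2 Lemma 3.7] [cite: MoonenZarhin1999LowDim, §3] -/
theorem IsRiemannForm.finrank_hodgeGroupLie_ne_ten_of_not_isSimple_of_finrank_eq_two (hη : IsRiemannForm Ψ η)
    (hg : finrank ℂ E = 2) (hX : ¬ IsSimple Ψ) : finrank ℝ (hodgeGroupLie Ψ) ≠ 10 := by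
  rcases hη.finrank_hodgeGroupLie_and_finrank_neronSeveriGroup_and_finrank_endAlgRat_of_not_isSimple hg hX with
    h | h | h | h | h <;> omega

/-- **An abelian surface with `dim_ℝ 𝔥𝔤_ℝ = 10` (`Hg(X) = Sp₄`, type **A**) is SIMPLE.**
[cite: FiteEtAl2012, §4.1 (type **A**: «`ℝ`, which is the generic case»)] [cite: MoonenZarhin1999LowDim, §2 (2.2) (Type I(1)) and §3] -/
theorem IsRiemannForm.isSimple_of_finrank_hodgeGroupLie_eq_ten (hη : IsRiemannForm Ψ η) (hg : finrank ℂ E = 2)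
    (h10 : finrank ℝ (hodgeGroupLie Ψ) = 10) : IsSimple Ψ := by
  by_contra hX
  exact hη.finrank_hodgeGroupLie_ne_ten_of_not_isSimple_of_finrank_eq_two hg hX h10

end NonSimple

/-! ## §3 Simple abelian surfaces: the four lines I(1), I(2), II(1), IV(2,1) -/

section Simple

variable {κ : Type} [Fintype κ] [DecidableEq κ] [Nonempty κ] {E : Type} [NormedAddCommGroup E] [NormedSpace ℂ E]
  [FiniteDimensional ℂ E] {Ψ : (κ → ℝ) ≃L[ℝ] E} {η : E [⋀^Fin 2]→L[ℝ] ℝ}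

/-- **THE FOUR LINES OF A SIMPLE ABELIAN SURFACE:
`(dim_ℝ 𝔥𝔤_ℝ(X), ρ(X), dim_ℚ End⁰(X)) ∈ {(10,1,1), (6,2,2), (3,3,4), (2,2,4)}`** — Type I(1) `End⁰ = ℚ`,
`Hg = Sp₄`: **A** `(10,1,1)`; Type I(2) real multiplication: **B** `(6,2,2)`; Type II(1) indefinite quaternion
multiplication (`ρ = 3e = 3`): **E** `(3,3,4)`; Type IV(2,1) quartic CM field: **D** `(2,2,4)`; type III excluded
(Shimura).  [cite: MoonenZarhin1999LowDim, §2 (2.2) `g = 2` (the four cases) and Prop. (2.4)]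
[cite: FiteEtAl2012, §4.1 (p0014 L45–L82: the simple alternatives of **B, D, E**; **A**) and §3.2 Lemma 3.7]
[cite: HulekLaface2019PicardNumbersAV, §3 («`ρ = 3e` for type II») and §5.1 Prop. 5.1] [cite: Lange2023AbelianVarietiesComplex, §5.1.5 Exercise (2)(b)] -/
theorem IsSimple.finrank_hodgeGroupLie_and_finrank_neronSeveriGroup_and_finrank_endAlgRat_of_finrank_eq_two
    (hX : IsSimple Ψ) (hη : IsRiemannForm Ψ η) (hg : finrank ℂ E = 2) :
    (finrank ℝ (hodgeGroupLie Ψ) = 10 ∧ finrank ℤ (neronSeveriGroup Ψ) = 1 ∧ finrank ℚ (endAlgRat Ψ) = 1) ∨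
      (finrank ℝ (hodgeGroupLie Ψ) = 6 ∧ finrank ℤ (neronSeveriGroup Ψ) = 2 ∧ finrank ℚ (endAlgRat Ψ) = 2) ∨
      (finrank ℝ (hodgeGroupLie Ψ) = 3 ∧ finrank ℤ (neronSeveriGroup Ψ) = 3 ∧ finrank ℚ (endAlgRat Ψ) = 4) ∨
      (finrank ℝ (hodgeGroupLie Ψ) = 2 ∧ finrank ℤ (neronSeveriGroup Ψ) = 2 ∧ finrank ℚ (endAlgRat Ψ) = 4) := by
  obtain ⟨G, hG⟩ := hη.exists_ratMatrix_latticeGram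
  -- the tree's `(ρ, dim End⁰)` table of simple surfaces
  have htab := hX.finrank_neronSeveriGroup_and_finrank_endAlgRat_of_finrank_eq_two hη hg
  rcases hX.isAlbertType_of_finrank_eq_two hη hG hg with hI | hII | hIII | hIV
  · -- type I: `e = [K : ℚ] ∣ 2`
    haveI : IsTotallyReal (centerField Ψ hX) := hI.isTotallyReal
    have hdvd : finrank ℚ (centerField Ψ hX) ∣ finrank ℂ E := hX.finrank_centerField_dvd_of_isTotallyReal
    rw [hg] at hdvd
    have hpos : 0 < finrank ℚ (centerField Ψ hX) := finrank_pos
    have hle : finrank ℚ (centerField Ψ hX) ≤ 2 := Nat.le_of_dvd two_pos hdvd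
    rcases (show finrank ℚ (centerField Ψ hX) = 1 ∨ finrank ℚ (centerField Ψ hX) = 2 by omega) with he | he
    · -- I(1): `End⁰ = ℚ`, `Hg = Sp₄`: `(10, 1, 1)`
      have hbot := hX.endAlgRat_eq_bot_of_finrank_eq_one_of_finrank_centerField_eq_one hI.finrank_eq_one he
      have h10 := hη.finrank_hodgeGroupLie_eq_ten_of_finrank_eq_two_of_endAlgRat_eq_bot hg hbot
      have hd : finrank ℚ (endAlgRat Ψ) = 1 := by rw [hbot]; exact Subalgebra.finrank_bot
      rcases htab with h | h | h | h
      · exact Or.inl ⟨h10, h.1, hd⟩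
      all_goals omega
    · -- I(2): real multiplication: `(6, 2, 2)`
      have h6 := hX.finrank_hodgeGroupLie_eq_six_of_isAlbertTypeI_of_finrank_centerField_eq_two hη hG hI he hg
      have hd := (hX.finrank_hodgeGroupLie_eq_six_iff_finrank_endAlgRat_eq_two_of_finrank_eq_two hη hg).1 h6
      rcases htab with h | h | h | h
      · omega
      · exact Or.inr (Or.inl ⟨h6, h.1, hd⟩)
      all_goals omega
  · -- type II: quaternion multiplication, `ρ = 3e = 3`: `(3, 3, 4)`
    haveI := hII.isQuaternionAlgebra
    have h3 := hX.finrank_hodgeGroupLie_eq_three_of_isAlbertTypeII_of_finrank_eq_two hη hG hII hg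
    have hρ := (hX.isTotallyIndefinite_of_finrank_eq_two hη hg).2
    rcases htab with h | h | h | h
    · omega
    · omega
    · exact Or.inr (Or.inr (Or.inl ⟨h3, hρ, h.2⟩))
    · omega
  · -- type III: excluded
    exact absurd hIII (hX.not_isAlbertTypeIII_of_finrank_eq_two hη hG hg)
  · -- type IV: quartic CM field, `Hg(X)` commutative: `(2, 2, 4)`
    have h2 := hX.finrank_hodgeGroupLie_eq_two_of_isAlbertTypeIV_of_finrank_eq_two hη hG hIV hg
    have hc := (hX.finrank_hodgeGroupLie_eq_two_iff_hodgeGroup_comm_of_finrank_eq_two hη hg).1 h2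
    obtain ⟨hcomm, h4⟩ := hX.endAlgRat_comm_and_finrank_eq_four_of_hodgeGroup_comm_of_finrank_eq_two hη hg hc
    have hρ := hX.finrank_neronSeveriGroup_eq_two_of_endAlgRat_comm_of_finrank_eq_two hη hg hcomm h4
    exact Or.inr (Or.inr (Or.inr ⟨h2, hρ, h4⟩))

end Simple

/-! ## §4 Every abelian surface: the six lines and the dictionary -/

section Every

variable {κ : Type} [Fintype κ] [DecidableEq κ] {E : Type} [NormedAddCommGroup E] [NormedSpace ℂ E]
  [FiniteDimensional ℂ E] {Ψ : (κ → ℝ) ≃L[ℝ] E} {η : E [⋀^Fin 2]→L[ℝ] ℝ}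

/-- **THE SIX ABSOLUTE TYPES OF ABELIAN SURFACES AT TORUS LEVEL: for every polarised complex abelian surface
`(dim_ℝ 𝔥𝔤_ℝ(X), ρ(X), dim_ℚ End⁰(X)) ∈ {(10,1,1), (6,2,2), (4,2,3), (2,2,4), (3,3,4), (1,4,8)}`** — the lines of
types **A** (`USp(4)`, `End_ℝ = ℝ`), **B** (`SU(2) × SU(2)`, `ℝ × ℝ`), **C** (`U(1) × SU(2)`, `ℂ × ℝ`),
**D** (`U(1) × U(1)`, `ℂ × ℂ`), **E** (`SU(2)`, `M₂(ℝ)`), **F** (`U(1)`, `M₂(ℂ)`): first coordinate = the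
dimension of the group, third = `dim_ℝ End(A)_ℝ`.  Simple: §3; non-simple: §2.
[cite: FiteEtAl2012, §4.1 (p0014 L45–L72: `End(A_K)_ℝ ∈ {ℝ, ℝ × ℝ, ℂ × ℝ, ℂ × ℂ, M₂(ℝ), M₂(ℂ)}`; p0014 L76–L82: «The six absolute types are in one-to-one correspondence with the six connected Lie subgroups of `USp(4)` appearing in Lemma 3.7 … **A**: `USp(4)`, **B**: `SU(2) × SU(2)`, **C**: `U(1) × SU(2)`, **D**: `U(1) × U(1)`, **E**: `SU(2)`, **F**: `U(1)`») and §3.2 Lemma 3.7]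
[cite: MoonenZarhin1999LowDim, §2 (2.1), (2.2), Prop. (2.4) and §3] [cite: HulekLaface2019PicardNumbersAV, §1 (p0003 L13–L14), §3, §5.1 Prop. 5.1]
[cite: Lange2023AbelianVarietiesComplex, §5.1.5 Exercise (2)(a), (b)] [cite: Beauville2014MaximalPicard, §3 Prop. 3] -/
theorem IsRiemannForm.finrank_hodgeGroupLie_and_finrank_neronSeveriGroup_and_finrank_endAlgRat_of_finrank_eq_two
    (hη : IsRiemannForm Ψ η) (hg : finrank ℂ E = 2) :
    (finrank ℝ (hodgeGroupLie Ψ) = 10 ∧ finrank ℤ (neronSeveriGroup Ψ) = 1 ∧ finrank ℚ (endAlgRat Ψ) = 1) ∨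
      (finrank ℝ (hodgeGroupLie Ψ) = 6 ∧ finrank ℤ (neronSeveriGroup Ψ) = 2 ∧ finrank ℚ (endAlgRat Ψ) = 2) ∨
      (finrank ℝ (hodgeGroupLie Ψ) = 4 ∧ finrank ℤ (neronSeveriGroup Ψ) = 2 ∧ finrank ℚ (endAlgRat Ψ) = 3) ∨
      (finrank ℝ (hodgeGroupLie Ψ) = 2 ∧ finrank ℤ (neronSeveriGroup Ψ) = 2 ∧ finrank ℚ (endAlgRat Ψ) = 4) ∨
      (finrank ℝ (hodgeGroupLie Ψ) = 3 ∧ finrank ℤ (neronSeveriGroup Ψ) = 3 ∧ finrank ℚ (endAlgRat Ψ) = 4) ∨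
      (finrank ℝ (hodgeGroupLie Ψ) = 1 ∧ finrank ℤ (neronSeveriGroup Ψ) = 4 ∧ finrank ℚ (endAlgRat Ψ) = 8) := by
  haveI : Nonempty κ := Fintype.card_pos_iff.1 (by rw [card_eq_two_mul_finrank Ψ, hg]; norm_num)
  by_cases hX : IsSimple Ψ
  · rcases hX.finrank_hodgeGroupLie_and_finrank_neronSeveriGroup_and_finrank_endAlgRat_of_finrank_eq_two hη hg with
      h | h | h | h <;> omega
  · rcases hη.finrank_hodgeGroupLie_and_finrank_neronSeveriGroup_and_finrank_endAlgRat_of_not_isSimple hg hX with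
      h | h | h | h | h <;> omega

/-- **`dim_ℝ 𝔥𝔤_ℝ = 10 ⟺ dim_ℚ End⁰(X) = 1`** (type **A**: `Hg(X) = Sp₄ ⟺ End⁰(X) = ℚ`), for every abelian surface.
[cite: FiteEtAl2012, §4.1 (type **A** `↔ USp(4)`)] [cite: MoonenZarhin1999LowDim, §2 (2.2) (Type I(1): «`End⁰(X) = ℚ`. Then `Hg(X) = Sp(V,φ) ≅ Sp_{4,ℚ}`»)] -/
theorem IsRiemannForm.finrank_hodgeGroupLie_eq_ten_iff_finrank_endAlgRat_eq_one_of_finrank_eq_two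
    (hη : IsRiemannForm Ψ η) (hg : finrank ℂ E = 2) :
    finrank ℝ (hodgeGroupLie Ψ) = 10 ↔ finrank ℚ (endAlgRat Ψ) = 1 := by
  have ht := hη.finrank_hodgeGroupLie_and_finrank_neronSeveriGroup_and_finrank_endAlgRat_of_finrank_eq_two hg
  constructor <;> intro h <;> rcases ht with ht | ht | ht | ht | ht | ht <;> omega

/-- **`dim_ℝ 𝔥𝔤_ℝ = 10 ⟺ ρ(X) = 1`** (type **A**; the very general abelian surface), for every abelian surface.
[cite: FiteEtAl2012, §4.1 (type **A**)] [cite: HulekLaface2019PicardNumbersAV, §1 (p0003 L14: «a very general abelian surface has `ρ = 1`») and §5.1 Prop. 5.1]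
[cite: MoonenZarhin1999LowDim, §2 (2.2) (Type I(1))] -/
theorem IsRiemannForm.finrank_hodgeGroupLie_eq_ten_iff_finrank_neronSeveriGroup_eq_one_of_finrank_eq_two
    (hη : IsRiemannForm Ψ η) (hg : finrank ℂ E = 2) :
    finrank ℝ (hodgeGroupLie Ψ) = 10 ↔ finrank ℤ (neronSeveriGroup Ψ) = 1 := by
  have ht := hη.finrank_hodgeGroupLie_and_finrank_neronSeveriGroup_and_finrank_endAlgRat_of_finrank_eq_two hg
  constructor <;> intro h <;> rcases ht with ht | ht | ht | ht | ht | ht <;> omega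

/-- **`dim_ℝ 𝔥𝔤_ℝ = 6 ⟺ dim_ℚ End⁰(X) = 2`** (type **B**, `SU(2) × SU(2)`: real multiplication by a real quadratic
field, or `E₁ × E₂` non-isogenous without CM), for every abelian surface.
[cite: FiteEtAl2012, §4.1 (type **B**: «`ℝ × ℝ`, which occurs when either `A_K` is isogenous to a product of nonisogenous elliptic curves without CM, or `A_K` is simple and `End(A_K)` is an order in a real quadratic field» `↔ SU(2) × SU(2)`)]
[cite: MoonenZarhin1999LowDim, §2 (2.2) (Type I(2)) and §3] -/
theorem IsRiemannForm.finrank_hodgeGroupLie_eq_six_iff_finrank_endAlgRat_eq_two_of_finrank_eq_two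
    (hη : IsRiemannForm Ψ η) (hg : finrank ℂ E = 2) :
    finrank ℝ (hodgeGroupLie Ψ) = 6 ↔ finrank ℚ (endAlgRat Ψ) = 2 := by
  have ht := hη.finrank_hodgeGroupLie_and_finrank_neronSeveriGroup_and_finrank_endAlgRat_of_finrank_eq_two hg
  constructor <;> intro h <;> rcases ht with ht | ht | ht | ht | ht | ht <;> omega

/-- **`dim_ℝ 𝔥𝔤_ℝ = 4 ⟺ dim_ℚ End⁰(X) = 3`** (type **C**, `U(1) × SU(2)`: `X ∼ E₁ × E₂` with exactly one CM factor),
for every abelian surface.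
[cite: FiteEtAl2012, §4.1 (type **C**: «`ℂ × ℝ`, which occurs when `A_K` is isogenous to a product of (necessarily nonisogenous) elliptic curves, one with CM and the other without CM» `↔ U(1) × SU(2)`)]
[cite: MoonenZarhin1999LowDim, §3 and §2 (2.1)] -/
theorem IsRiemannForm.finrank_hodgeGroupLie_eq_four_iff_finrank_endAlgRat_eq_three_of_finrank_eq_two
    (hη : IsRiemannForm Ψ η) (hg : finrank ℂ E = 2) :
    finrank ℝ (hodgeGroupLie Ψ) = 4 ↔ finrank ℚ (endAlgRat Ψ) = 3 := by
  have ht := hη.finrank_hodgeGroupLie_and_finrank_neronSeveriGroup_and_finrank_endAlgRat_of_finrank_eq_two hg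
  constructor <;> intro h <;> rcases ht with ht | ht | ht | ht | ht | ht <;> omega

/-- **`dim_ℝ 𝔥𝔤_ℝ = 3 ⟺ ρ(X) = 3`, FOR EVERY ABELIAN SURFACE** (type **E**, `SU(2)`: quaternion multiplication,
or `X ∼ E²` with `E` without CM; the converse of g48-#6's
`IsRiemannForm.finrank_hodgeGroupLie_eq_three_of_finrank_neronSeveriGroup_eq_three`).
[cite: FiteEtAl2012, §4.1 (type **E**: «`M₂(ℝ)`, which occurs when either `A_K` is isogenous to the square of an elliptic curve without CM, or `A_K` is simple and `End(A_K)` is an order in a division quaternion algebra over `ℚ`» `↔ SU(2)`) and §3.2 Lemma 3.7]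
[cite: HulekLaface2019PicardNumbersAV, §1 (p0003 L13–L14) and §3 («`ρ = 3e` for type II»)] [cite: MoonenZarhin1999LowDim, §2 (2.1), (2.2) (Type II(1))] -/
theorem IsRiemannForm.finrank_hodgeGroupLie_eq_three_iff_finrank_neronSeveriGroup_eq_three_of_finrank_eq_two
    (hη : IsRiemannForm Ψ η) (hg : finrank ℂ E = 2) :
    finrank ℝ (hodgeGroupLie Ψ) = 3 ↔ finrank ℤ (neronSeveriGroup Ψ) = 3 := by
  have ht := hη.finrank_hodgeGroupLie_and_finrank_neronSeveriGroup_and_finrank_endAlgRat_of_finrank_eq_two hg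
  constructor <;> intro h <;> rcases ht with ht | ht | ht | ht | ht | ht <;> omega

/-- `∃`-polarisation form: **an abelian surface has `dim_ℝ 𝔥𝔤_ℝ = 3` iff `ρ(X) = 3`.**
[cite: FiteEtAl2012, §4.1 (type **E** `↔ SU(2)`) and §3.2 Lemma 3.7] [cite: HulekLaface2019PicardNumbersAV, §1 and §3] -/
theorem IsAbelianVariety.finrank_hodgeGroupLie_eq_three_iff_finrank_neronSeveriGroup_eq_three
    (hA : IsAbelianVariety Ψ) (hg : finrank ℂ E = 2) :
    finrank ℝ (hodgeGroupLie Ψ) = 3 ↔ finrank ℤ (neronSeveriGroup Ψ) = 3 := by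
  obtain ⟨η, hη⟩ := hA
  exact hη.finrank_hodgeGroupLie_eq_three_iff_finrank_neronSeveriGroup_eq_three_of_finrank_eq_two hg

/-- **`dim_ℝ 𝔥𝔤_ℝ = 3 ⟺ dim_ℚ End⁰(X) = 4 ∧ ρ(X) = 3`** (type **E**: `End_ℝ = M₂(ℝ)`), for every abelian surface.
[cite: FiteEtAl2012, §4.1 (type **E** `↔ SU(2)`)] [cite: HulekLaface2019PicardNumbersAV, §1 and §3] -/
theorem IsRiemannForm.finrank_hodgeGroupLie_eq_three_iff_finrank_endAlgRat_eq_four_and_of_finrank_eq_two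
    (hη : IsRiemannForm Ψ η) (hg : finrank ℂ E = 2) :
    finrank ℝ (hodgeGroupLie Ψ) = 3 ↔ finrank ℚ (endAlgRat Ψ) = 4 ∧ finrank ℤ (neronSeveriGroup Ψ) = 3 := by
  have ht := hη.finrank_hodgeGroupLie_and_finrank_neronSeveriGroup_and_finrank_endAlgRat_of_finrank_eq_two hg
  constructor <;> intro h <;> rcases ht with ht | ht | ht | ht | ht | ht <;> omega

/-- **`dim_ℝ 𝔥𝔤_ℝ = 2 ⟺ dim_ℚ End⁰(X) = 4 ∧ ρ(X) = 2`** (type **D**, `U(1) × U(1)`: `End_ℝ = ℂ × ℂ` — a quartic CM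
field on a simple surface, or `E₁ × E₂` non-isogenous with CM), for every abelian surface.
[cite: FiteEtAl2012, §4.1 (type **D**: «`ℂ × ℂ`, which occurs when either `A_K` is isogenous to a product of nonisogenous elliptic curves with CM, or `A_K` is simple and `End(A_K)` is an order in a quartic CM-field» `↔ U(1) × U(1)`)]
[cite: MoonenZarhin1999LowDim, §2 (2.2) (Type IV(2,1)) and Prop. (2.4) (2)] -/
theorem IsRiemannForm.finrank_hodgeGroupLie_eq_two_iff_finrank_endAlgRat_eq_four_and_of_finrank_eq_two
    (hη : IsRiemannForm Ψ η) (hg : finrank ℂ E = 2) :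
    finrank ℝ (hodgeGroupLie Ψ) = 2 ↔ finrank ℚ (endAlgRat Ψ) = 4 ∧ finrank ℤ (neronSeveriGroup Ψ) = 2 := by
  have ht := hη.finrank_hodgeGroupLie_and_finrank_neronSeveriGroup_and_finrank_endAlgRat_of_finrank_eq_two hg
  constructor <;> intro h <;> rcases ht with ht | ht | ht | ht | ht | ht <;> omega

/-- **`dim_ℝ 𝔥𝔤_ℝ = 2 ⟺ Hg(X)` is commutative and `ρ(X) = 2`** (CM type, not isotypic), for every abelian surface
(`dim_ℝ 𝔥𝔤_ℝ ≤ 2 ⟺ Hg(X)` commutative; `= 1 ⟺ ρ = 4`).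
[cite: MoonenZarhin1999LowDim, §2 Prop. (2.4) (2) («Suppose `X` is of CM-type. Then `Hg(X)` is a torus»)] [cite: FiteEtAl2012, §4.1 (types **D**, **F**)] -/
theorem IsRiemannForm.finrank_hodgeGroupLie_eq_two_iff_hodgeGroup_comm_and_of_finrank_eq_two
    (hη : IsRiemannForm Ψ η) (hg : finrank ℂ E = 2) :
    finrank ℝ (hodgeGroupLie Ψ) = 2 ↔
      (∀ M ∈ hodgeGroup Ψ, ∀ N ∈ hodgeGroup Ψ, M * N = N * M) ∧ finrank ℤ (neronSeveriGroup Ψ) = 2 := by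
  haveI : Nonempty κ := Fintype.card_pos_iff.1 (by rw [card_eq_two_mul_finrank Ψ, hg]; norm_num)
  have ht := hη.finrank_hodgeGroupLie_and_finrank_neronSeveriGroup_and_finrank_endAlgRat_of_finrank_eq_two hg
  refine ⟨fun h ↦ ⟨IsAbelianVariety.hodgeGroup_comm_of_finrank_hodgeGroupLie_le_two ⟨η, hη⟩ h.le, ?_⟩, fun h ↦ ?_⟩
  · rcases ht with ht | ht | ht | ht | ht | ht <;> omega
  · have hle := hη.finrank_hodgeGroupLie_le_of_hodgeGroup_comm h.1
    rw [hg] at hle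
    rcases ht with ht | ht | ht | ht | ht | ht <;> omega

/-- **`dim_ℝ 𝔥𝔤_ℝ = 1 ⟺ dim_ℚ End⁰(X) = 8`** (type **F**, `U(1)`: `X ∼ E²` with `E` CM, `End⁰ = M₂(K)`), for every
abelian surface. [cite: FiteEtAl2012, §4.1 (type **F**: «`M₂(ℂ)`, which occurs when `A_K` is isogenous to the square of an elliptic curve with CM» `↔ U(1)`)]
[cite: Beauville2014MaximalPicard, §3 Prop. 3] -/
theorem IsRiemannForm.finrank_hodgeGroupLie_eq_one_iff_finrank_endAlgRat_eq_eight_of_finrank_eq_two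
    (hη : IsRiemannForm Ψ η) (hg : finrank ℂ E = 2) :
    finrank ℝ (hodgeGroupLie Ψ) = 1 ↔ finrank ℚ (endAlgRat Ψ) = 8 := by
  have ht := hη.finrank_hodgeGroupLie_and_finrank_neronSeveriGroup_and_finrank_endAlgRat_of_finrank_eq_two hg
  constructor <;> intro h <;> rcases ht with ht | ht | ht | ht | ht | ht <;> omega

/-- **`dim_ℝ 𝔥𝔤_ℝ = 1 ⟺ ρ(X) = 4`** (type **F**; maximal Picard number) — the case `g = 2` of the tree's
`coe_hodgeGroup_eq_range_iff_finrank_hodgeGroupLie_eq_one` ∧ `coe_hodgeGroup_eq_range_iff_finrank_neronSeveriGroup_eq_sq`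
(`Hg(X) = h(S¹) ⟺ dim 𝔥𝔤 = 1 ⟺ ρ = g²`), read here off the table.
[cite: Beauville2014MaximalPicard, §3 Prop. 3 ((i) ⟺ (ii))] [cite: FiteEtAl2012, §4.1 (type **F** `↔ U(1)`)] -/
theorem IsRiemannForm.finrank_hodgeGroupLie_eq_one_iff_finrank_neronSeveriGroup_eq_four_of_finrank_eq_two
    (hη : IsRiemannForm Ψ η) (hg : finrank ℂ E = 2) :
    finrank ℝ (hodgeGroupLie Ψ) = 1 ↔ finrank ℤ (neronSeveriGroup Ψ) = 4 := by
  have ht := hη.finrank_hodgeGroupLie_and_finrank_neronSeveriGroup_and_finrank_endAlgRat_of_finrank_eq_two hg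
  constructor <;> intro h <;> rcases ht with ht | ht | ht | ht | ht | ht <;> omega

/-- **`ρ(X) = 2 ⟺ dim_ℝ 𝔥𝔤_ℝ ∈ {2, 4, 6}`** (types **D, C, B**), for every abelian surface: the Picard number is a
function of `dim Hg(X)` (`10 ↦ 1`, `6, 4, 2 ↦ 2`, `3 ↦ 3`, `1 ↦ 4`).
[cite: FiteEtAl2012, §4.1 (p0014 L45–L82)] [cite: HulekLaface2019PicardNumbersAV, §1 (p0003 L13–L14)] -/
theorem IsRiemannForm.finrank_neronSeveriGroup_eq_two_iff_finrank_hodgeGroupLie_mem_of_finrank_eq_two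
    (hη : IsRiemannForm Ψ η) (hg : finrank ℂ E = 2) :
    finrank ℤ (neronSeveriGroup Ψ) = 2 ↔ finrank ℝ (hodgeGroupLie Ψ) ∈ ({2, 4, 6} : Finset ℕ) := by
  have ht := hη.finrank_hodgeGroupLie_and_finrank_neronSeveriGroup_and_finrank_endAlgRat_of_finrank_eq_two hg
  simp only [Finset.mem_insert, Finset.mem_singleton]
  constructor <;> intro h <;> rcases ht with ht | ht | ht | ht | ht | ht <;> omega

/-- **`dim_ℚ End⁰(X)` and `ρ(X)` DETERMINE `dim Hg(X)`** for abelian surfaces: two polarised abelian surfaces with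
the same `dim_ℚ End⁰` and the same Picard number have Hodge groups of the same dimension (the absolute type is an
invariant of `(End⁰ ⊗ ℝ, ρ)`; `ρ` is only needed to separate **D** from **E** at `dim End⁰ = 4`).
[cite: FiteEtAl2012, §4.1 (p0014 L45–L82: the absolute type is determined by `End(A_K)_ℝ`)] -/
theorem IsRiemannForm.finrank_hodgeGroupLie_eq_of_finrank_endAlgRat_eq_of_finrank_neronSeveriGroup_eq
    {κ' : Type} [Fintype κ'] [DecidableEq κ'] {E' : Type} [NormedAddCommGroup E'] [NormedSpace ℂ E']
    [FiniteDimensional ℂ E'] {Ψ' : (κ' → ℝ) ≃L[ℝ] E'} {η' : E' [⋀^Fin 2]→L[ℝ] ℝ}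
    (hη : IsRiemannForm Ψ η) (hη' : IsRiemannForm Ψ' η') (hg : finrank ℂ E = 2) (hg' : finrank ℂ E' = 2)
    (hd : finrank ℚ (endAlgRat Ψ) = finrank ℚ (endAlgRat Ψ'))
    (hρ : finrank ℤ (neronSeveriGroup Ψ) = finrank ℤ (neronSeveriGroup Ψ')) :
    finrank ℝ (hodgeGroupLie Ψ) = finrank ℝ (hodgeGroupLie Ψ') := by
  have ht := hη.finrank_hodgeGroupLie_and_finrank_neronSeveriGroup_and_finrank_endAlgRat_of_finrank_eq_two hg
  have ht' := hη'.finrank_hodgeGroupLie_and_finrank_neronSeveriGroup_and_finrank_endAlgRat_of_finrank_eq_two hg'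
  rcases ht with ht | ht | ht | ht | ht | ht <;> rcases ht' with ht' | ht' | ht' | ht' | ht' | ht' <;> omega

end Every

/-! ## §5 Realisation: all six types occur, and nothing else does -/

section Realisation

/-- **ALL SIX ABSOLUTE TYPES OCCUR OVER `ℂ`**: for each line `(h, ρ, d)` of the table there is a polarised complex
abelian surface with `dim_ℝ 𝔥𝔤_ℝ = h`, `ρ(X) = ρ`, `dim_ℚ End⁰(X) = d` — the tree's realisation of the six
`(ρ, dim End⁰)` lines (`exists_abelianSurface_finrank_neronSeveriGroup_and_finrank_endAlgRat_eq`: the very general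
surface `ℂ²/(iY ℤ² ⊕ ℤ²)`, `E₁ × E₂` of the five kinds) read through §4, `(ρ, dim End⁰)` determining `dim Hg`.
[cite: FiteEtAl2012, §4.1 (p0014 L45–L82: the six types and when each «occurs»)] [cite: HulekLaface2019PicardNumbersAV, §1 (p0003 L13–L14: «For abelian surfaces all possible Picard numbers between `1` […] and `4` occur»)]
[cite: Lange2023AbelianVarietiesComplex, §5.1.5 Exercise (2)] -/
theorem exists_abelianSurface_finrank_hodgeGroupLie_and_finrank_neronSeveriGroup_and_finrank_endAlgRat_eq
    {h ρ d : ℕ} (ht : (h = 10 ∧ ρ = 1 ∧ d = 1) ∨ (h = 6 ∧ ρ = 2 ∧ d = 2) ∨ (h = 4 ∧ ρ = 2 ∧ d = 3) ∨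
      (h = 2 ∧ ρ = 2 ∧ d = 4) ∨ (h = 3 ∧ ρ = 3 ∧ d = 4) ∨ (h = 1 ∧ ρ = 4 ∧ d = 8)) :
    ∃ (κ : Type) (_ : Fintype κ) (_ : DecidableEq κ) (E : Type) (_ : NormedAddCommGroup E) (_ : NormedSpace ℂ E)
      (Ψ : (κ → ℝ) ≃L[ℝ] E), IsAbelianVariety Ψ ∧ finrank ℂ E = 2 ∧ finrank ℝ (hodgeGroupLie Ψ) = h ∧
        finrank ℤ (neronSeveriGroup Ψ) = ρ ∧ finrank ℚ (endAlgRat Ψ) = d := by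
  have hρd : (ρ = 1 ∧ d = 1) ∨ (ρ = 2 ∧ d = 2) ∨ (ρ = 2 ∧ d = 3) ∨ (ρ = 2 ∧ d = 4) ∨ (ρ = 3 ∧ d = 4) ∨
      (ρ = 4 ∧ d = 8) := by omega
  obtain ⟨κ, _, _, E, _, _, Ψ, hA, hg, hρ', hd'⟩ :=
    exists_abelianSurface_finrank_neronSeveriGroup_and_finrank_endAlgRat_eq hρd
  haveI : FiniteDimensional ℂ E := .of_finrank_pos (by omega)
  obtain ⟨η, hη⟩ := hA
  refine ⟨κ, inferInstance, inferInstance, E, inferInstance, inferInstance, Ψ, ⟨η, hη⟩, hg, ?_, hρ', hd'⟩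
  rcases hη.finrank_hodgeGroupLie_and_finrank_neronSeveriGroup_and_finrank_endAlgRat_of_finrank_eq_two hg with
    t | t | t | t | t | t <;> omega

/-- **THE SIX TYPES, EXACTLY: `{(dim_ℝ 𝔥𝔤_ℝ(X), ρ(X), dim_ℚ End⁰(X))} = {(10,1,1), (6,2,2), (4,2,3), (2,2,4), (3,3,4), (1,4,8)}`
over all polarised complex abelian surfaces** (§4: nothing else occurs; the previous theorem: each occurs).
[cite: FiteEtAl2012, §4.1 (p0014 L45–L82) and §3.2 Lemma 3.7] [cite: HulekLaface2019PicardNumbersAV, §1 (p0003 L13–L14)]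
[cite: MoonenZarhin1999LowDim, §2 (2.2) and §3] -/
theorem exists_abelianSurface_finrank_hodgeGroupLie_and_finrank_neronSeveriGroup_and_finrank_endAlgRat_eq_iff
    {h ρ d : ℕ} :
    (∃ (κ : Type) (_ : Fintype κ) (_ : DecidableEq κ) (E : Type) (_ : NormedAddCommGroup E) (_ : NormedSpace ℂ E)
      (Ψ : (κ → ℝ) ≃L[ℝ] E), IsAbelianVariety Ψ ∧ finrank ℂ E = 2 ∧ finrank ℝ (hodgeGroupLie Ψ) = h ∧
        finrank ℤ (neronSeveriGroup Ψ) = ρ ∧ finrank ℚ (endAlgRat Ψ) = d) ↔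
      (h = 10 ∧ ρ = 1 ∧ d = 1) ∨ (h = 6 ∧ ρ = 2 ∧ d = 2) ∨ (h = 4 ∧ ρ = 2 ∧ d = 3) ∨
        (h = 2 ∧ ρ = 2 ∧ d = 4) ∨ (h = 3 ∧ ρ = 3 ∧ d = 4) ∨ (h = 1 ∧ ρ = 4 ∧ d = 8) := by
  refine ⟨?_, exists_abelianSurface_finrank_hodgeGroupLie_and_finrank_neronSeveriGroup_and_finrank_endAlgRat_eq⟩
  rintro ⟨κ, _, _, E, _, _, Ψ, ⟨η, hη⟩, hg, rfl, rfl, rfl⟩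
  haveI : FiniteDimensional ℂ E := .of_finrank_pos (by omega)
  exact hη.finrank_hodgeGroupLie_and_finrank_neronSeveriGroup_and_finrank_endAlgRat_of_finrank_eq_two hg

/-- **The set of dimensions of Hodge groups of complex abelian surfaces is exactly `{1, 2, 3, 4, 6, 10}`**
(`U(1), U(1)², SU(2), U(1) × SU(2), SU(2)², USp(4)`). [cite: FiteEtAl2012, §3.2 Lemma 3.7 and §4.1 (p0014 L76–L82)]
[cite: MoonenZarhin1999LowDim, §2 (2.2) and §3] -/
theorem exists_abelianSurface_finrank_hodgeGroupLie_eq_iff {h : ℕ} :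
    (∃ (κ : Type) (_ : Fintype κ) (_ : DecidableEq κ) (E : Type) (_ : NormedAddCommGroup E) (_ : NormedSpace ℂ E)
      (Ψ : (κ → ℝ) ≃L[ℝ] E), IsAbelianVariety Ψ ∧ finrank ℂ E = 2 ∧ finrank ℝ (hodgeGroupLie Ψ) = h) ↔
      h ∈ ({1, 2, 3, 4, 6, 10} : Finset ℕ) := by
  simp only [Finset.mem_insert, Finset.mem_singleton]
  constructor
  · rintro ⟨κ, _, _, E, _, _, Ψ, ⟨η, hη⟩, hg, rfl⟩
    haveI : FiniteDimensional ℂ E := .of_finrank_pos (by omega)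
    rcases hη.finrank_hodgeGroupLie_and_finrank_neronSeveriGroup_and_finrank_endAlgRat_of_finrank_eq_two hg with
      t | t | t | t | t | t <;> omega
  · intro hh
    obtain ⟨ρ, d, ht⟩ : ∃ ρ d : ℕ, (h = 10 ∧ ρ = 1 ∧ d = 1) ∨ (h = 6 ∧ ρ = 2 ∧ d = 2) ∨ (h = 4 ∧ ρ = 2 ∧ d = 3) ∨
        (h = 2 ∧ ρ = 2 ∧ d = 4) ∨ (h = 3 ∧ ρ = 3 ∧ d = 4) ∨ (h = 1 ∧ ρ = 4 ∧ d = 8) := by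
      rcases hh with rfl | rfl | rfl | rfl | rfl | rfl
      · exact ⟨4, 8, by omega⟩
      · exact ⟨2, 4, by omega⟩
      · exact ⟨3, 4, by omega⟩
      · exact ⟨2, 3, by omega⟩
      · exact ⟨2, 2, by omega⟩
      · exact ⟨1, 1, by omega⟩
    obtain ⟨κ, _, _, E, _, _, Ψ, hA, hg, hh', -, -⟩ :=
      exists_abelianSurface_finrank_hodgeGroupLie_and_finrank_neronSeveriGroup_and_finrank_endAlgRat_eq ht
    exact ⟨κ, inferInstance, inferInstance, E, inferInstance, inferInstance, Ψ, hA, hg, hh'⟩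

end Realisation

end ComplexTorus

end Literature.Geometry.Kaehler
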